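import Literature.NumberTheory.Automorphic.MatrixConeHyperbolicVolume
import HarnessLib

/-!
# Counting lattice points in the cone over a subset of `ℍ`:
# `#{x ∈ Λ : 0 < det x ≤ T, x • i ∈ S} ~ (π/2) μ(S) T² / covol(Λ)`

Topic `NumberTheory/Automorphic`; theorems only (no definition, no named fact, no instance).
Let `Λ ⊆ M₂(ℝ) ≅ ℝ⁴` be a full `ℤ`-lattice, given as the `ℤ`-span of an `ℝ`-basis `v` of
`ℝ^{Fin 2 × Fin 2}` (matrices read through their four entries), and let `S ⊆ ℍ` be measurable,
with null topological boundary, and contained in a box `|Re z| ≤ R`, `δ ≤ Im z ≤ R` (`δ > 0`).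
Then (`tendsto_card_cone_div_sq`)

  `#{x ∈ Λ : 0 < det x ≤ T, x • i ∈ S} / T² ⟶ (π / 2) μ(S) / |det v|`   (`T → ∞`),

`μ` the hyperbolic measure and `|det v|` the covolume of `Λ` (determinant of the entry matrix of
`v`). This is Mathlib's lattice-point count `ZLattice.covolume.tendsto_card_le_div` (gauge
`F = det²`, homogeneous of degree `4`) applied to the cone `X = {x : det x > 0, x • i ∈ S}`, whose
section `{F ≤ 1}` has volume `(π/2) μ(S)` (`volume_cone_eq`, `MatrixConeHyperbolicVolume.lean`),
is bounded (on the cone `‖x‖² ≤ det x · (2R² + 1)/δ`), and has null boundary: its boundary lies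
in `{0}`, the cone over `∂S` (null since `μ(∂S) = 0`, `volume_cone_eq_zero_of_null`) and the slice
`{det = 1}` over `S̄` (null by squeezing between the cones `det ≤ 1` and `det ≤ 1 - ε`).

This is the analytic half of Eichler's lattice-point method for the covolume of the unit group of
an order in an indefinite quaternion algebra (Vignéras, LNM 800, Ch. IV §1; Shimizu 1963 §§2–3):
brick "B1" of the `D > 1` branch of the proof of
`Literature.NumberTheory.Automorphic.ShimuraCurveData.volume_fd_eq`.

## References

* M.-F. Vignéras, *Arithmétique des algèbres de quaternions*, LNM 800 (1980), Ch. IV §1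
  [VignerasLNM800].
* H. Shimizu, Ann. of Math. 77 (1963), §§2–3 [Shimizu1963].
-/

noncomputable section

open _root_.MeasureTheory _root_.MeasureTheory.Measure Complex Set Filter Bornology
open scoped Real ENNReal ComplexConjugate MatrixGroups Topology

namespace Literature.NumberTheory.Automorphic

/-! ### 1. Matrices through their entries: `ℝ^{Fin 2 × Fin 2}` -/

/-- Reading a `2 × 2` real matrix through its four entries preserves Lebesgue measure
(`M₂(ℝ) = (Fin 2 → Fin 2 → ℝ) → (Fin 2 × Fin 2 → ℝ)`, both with the product measure). [folklore] -/
theorem measurePreserving_entries :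
    MeasurePreserving (fun x : Fin 2 → Fin 2 → ℝ => fun k : Fin 2 × Fin 2 => x k.1 k.2) volume volume := by
  have hf : Measurable fun x : Fin 2 → Fin 2 → ℝ => fun k : Fin 2 × Fin 2 => x k.1 k.2 :=
    measurable_pi_lambda _ fun k => (measurable_pi_apply k.2).comp (measurable_pi_apply k.1)
  refine ⟨hf, ?_⟩
  refine (Measure.pi_eq fun s hs => ?_).symm
  rw [Measure.map_apply hf (MeasurableSet.univ_pi hs)]
  have hpre : (fun x : Fin 2 → Fin 2 → ℝ => fun k : Fin 2 × Fin 2 => x k.1 k.2) ⁻¹' Set.pi univ s =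
      Set.pi univ fun i => Set.pi univ fun j => s (i, j) := by
    ext x
    simp only [mem_preimage, mem_univ_pi, Prod.forall]
  rw [hpre, volume_pi_pi]
  simp_rw [volume_pi_pi]
  rw [← Finset.univ_product_univ, Finset.prod_product]

/-- The cone conditions in entry coordinates (`exists_gl_entries_iff`). [folklore] -/
theorem exists_gl_entries_iff' (x : Fin 2 × Fin 2 → ℝ) (p : ℝ → Prop) (S : Set UpperHalfPlane) :
    (∃ g : GL (Fin 2) ℝ, (∀ i j, g i j = x (i, j)) ∧ 0 < g.det.val ∧ p g.det.val ∧
        g • UpperHalfPlane.I ∈ S) ↔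
      0 < (conj (⟨x (0, 0), x (0, 1)⟩ : ℂ) * ⟨x (1, 0), x (1, 1)⟩).im ∧
        p (conj (⟨x (0, 0), x (0, 1)⟩ : ℂ) * ⟨x (1, 0), x (1, 1)⟩).im ∧
        conj ((⟨x (0, 0), x (0, 1)⟩ : ℂ) / ⟨x (1, 0), x (1, 1)⟩) ∈ UpperHalfPlane.coe '' S :=
  exists_gl_entries_iff (fun i j => x (i, j)) p S

/-- The cone over a measurable `S` is measurable (entry coordinates). [folklore] -/
theorem measurableSet_cone' {S : Set UpperHalfPlane} (hS : MeasurableSet S) {p : ℝ → Prop}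
    (hp : MeasurableSet {t | p t}) :
    MeasurableSet {x : Fin 2 × Fin 2 → ℝ | ∃ g : GL (Fin 2) ℝ, (∀ i j, g i j = x (i, j)) ∧
      0 < g.det.val ∧ p g.det.val ∧ g • UpperHalfPlane.I ∈ S} := by
  have hmeas : Measurable fun x : Fin 2 × Fin 2 → ℝ => fun i j : Fin 2 => x (i, j) :=
    measurable_pi_lambda _ fun i => measurable_pi_lambda _ fun j => measurable_pi_apply (i, j)
  exact hmeas (measurableSet_cone hS hp (C := {x : Fin 2 → Fin 2 → ℝ | ∃ g : GL (Fin 2) ℝ,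
    (∀ i j, g i j = x i j) ∧ 0 < g.det.val ∧ p g.det.val ∧ g • UpperHalfPlane.I ∈ S})
    (fun x => Iff.rfl))

/-- **The cone volume in entry coordinates**: `vol{x : 0 < det x ≤ T, x • i ∈ S} = (π T²/2) μ(S)`.
[cite: VignerasLNM800, Ch. IV §1] -/
theorem volume_cone_eq' {S : Set UpperHalfPlane} (hS : MeasurableSet S) {T : ℝ} (hT : 0 ≤ T) :
    volume {x : Fin 2 × Fin 2 → ℝ | ∃ g : GL (Fin 2) ℝ, (∀ i j, g i j = x (i, j)) ∧
      0 < g.det.val ∧ g.det.val ≤ T ∧ g • UpperHalfPlane.I ∈ S} =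
      ENNReal.ofReal (π * T ^ 2 / 2) * volume S := by
  rw [← measurePreserving_entries.measure_preimage
    (measurableSet_cone' hS (p := fun t => t ≤ T) measurableSet_Iic).nullMeasurableSet]
  exact volume_cone_eq hS hT (fun x => Iff.rfl)

/-- A cone over a null set is null (entry coordinates). [folklore] -/
theorem volume_cone_eq_zero_of_null' {S : Set UpperHalfPlane} (hS : MeasurableSet S)
    (h0 : volume S = 0) :
    volume {x : Fin 2 × Fin 2 → ℝ | ∃ g : GL (Fin 2) ℝ, (∀ i j, g i j = x (i, j)) ∧
      0 < g.det.val ∧ g • UpperHalfPlane.I ∈ S} = 0 := by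
  have hm : MeasurableSet {x : Fin 2 × Fin 2 → ℝ | ∃ g : GL (Fin 2) ℝ, (∀ i j, g i j = x (i, j)) ∧
      0 < g.det.val ∧ g • UpperHalfPlane.I ∈ S} := by
    have h := measurableSet_cone' hS (p := fun _ => True) (by simp)
    simpa only [true_and] using h
  rw [← measurePreserving_entries.measure_preimage hm.nullMeasurableSet]
  exact volume_cone_eq_zero_of_null hS h0 (fun x => Iff.rfl)


/-! ### 2. Geometry on the cone: `|r|² + |w|² = |w|² (|z|² + 1)`, `|w|² Im z = det` -/

/-- `det = Im(r̄ w)` written out in the entries. [folklore] -/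
theorem im_conj_mul_eq_det (x : Fin 2 × Fin 2 → ℝ) :
    (conj (⟨x (0, 0), x (0, 1)⟩ : ℂ) * ⟨x (1, 0), x (1, 1)⟩).im =
      x (0, 0) * x (1, 1) - x (0, 1) * x (1, 0) := by
  simp [Complex.mul_im]
  ring

/-- On the cone: `|w|² · Im z = det` and `|r|² = |z|² |w|²` for `z = \overline{r/w}`, `w ≠ 0`. [folklore] -/
theorem normSq_mul_im_conj_div (r w : ℂ) (hw : w ≠ 0) :
    Complex.normSq w * (conj (r / w)).im = (conj r * w).im ∧
      Complex.normSq r = Complex.normSq (conj (r / w)) * Complex.normSq w := by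
  constructor
  · rw [← im_mul_normSq, conj_div_mul_normSq r w hw]
  · rw [Complex.normSq_conj, Complex.normSq_div,
      div_mul_cancel₀ _ ((Complex.normSq_pos.mpr hw).ne')]

/-- **The cone over a box is thin near `det = 0`**: if `0 < det`, `z = \overline{r/w}` has
`|Re z| ≤ R`, `δ ≤ Im z ≤ R` (`δ > 0`), then `|r|² + |w|² ≤ ((2R² + 1)/δ) · det`. [folklore] -/
theorem normSq_add_normSq_le {r w : ℂ} {R δ : ℝ} (hδ : 0 < δ) (hpos : 0 < (conj r * w).im)
    (hre : |(conj (r / w)).re| ≤ R) (him : δ ≤ (conj (r / w)).im) (him' : (conj (r / w)).im ≤ R) :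
    Complex.normSq r + Complex.normSq w ≤ (2 * R ^ 2 + 1) / δ * (conj r * w).im := by
  have hw : w ≠ 0 := by rintro rfl; simp at hpos
  obtain ⟨h1, h2⟩ := normSq_mul_im_conj_div r w hw
  set z : ℂ := conj (r / w) with hz
  have hw0 : 0 < Complex.normSq w := Complex.normSq_pos.mpr hw
  have hw_le : Complex.normSq w ≤ (conj r * w).im / δ := by
    rw [le_div_iff₀ hδ, ← h1]
    exact mul_le_mul_of_nonneg_left him hw0.le
  have hzns : Complex.normSq z ≤ 2 * R ^ 2 := by
    rw [Complex.normSq_apply]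
    have h3 := abs_le.mp hre
    have h4 : 0 ≤ z.im := le_trans hδ.le him
    nlinarith
  calc Complex.normSq r + Complex.normSq w
      = Complex.normSq w * (Complex.normSq z + 1) := by rw [h2]; ring
    _ ≤ (conj r * w).im / δ * (2 * R ^ 2 + 1) := by
        apply mul_le_mul hw_le (by linarith) (by linarith [Complex.normSq_nonneg z])
          (div_nonneg hpos.le hδ.le)
    _ = (2 * R ^ 2 + 1) / δ * (conj r * w).im := by ring

/-- Entries are bounded by the rows: `x₀₀², x₀₁² ≤ |r|²`, `x₁₀², x₁₁² ≤ |w|²`. [folklore] -/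
theorem sq_entry_le_normSq_add_normSq (x : Fin 2 × Fin 2 → ℝ) (k : Fin 2 × Fin 2) :
    x k ^ 2 ≤ Complex.normSq (⟨x (0, 0), x (0, 1)⟩ : ℂ) + Complex.normSq (⟨x (1, 0), x (1, 1)⟩ : ℂ) := by
  obtain ⟨i, j⟩ := k
  simp only [Complex.normSq_mk]
  fin_cases i <;> fin_cases j <;> simp <;> nlinarith [sq_nonneg (x (0,0)), sq_nonneg (x (0,1)),
    sq_nonneg (x (1,0)), sq_nonneg (x (1,1))]

/-! ### 3. A bounded subset of `ℍ` away from the real axis has finite hyperbolic area -/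

/-- A box `|Re z| ≤ R`, `δ ≤ Im z ≤ R` (`δ > 0`) lies in a hyperbolic ball around `i`. [folklore] -/
theorem subset_closedBall_I_of_bounds {S : Set UpperHalfPlane} {R δ : ℝ} (hδ : 0 < δ)
    (hbd : ∀ z ∈ S, |z.re| ≤ R ∧ δ ≤ z.im ∧ z.im ≤ R) :
    S ⊆ Metric.closedBall UpperHalfPlane.I ((2 * |R| + 1) / Real.sqrt δ) := by
  intro z hz
  obtain ⟨hre, him, him'⟩ := hbd z hz
  rw [Metric.mem_closedBall]
  have h1 := UpperHalfPlane.dist_le_dist_coe_div_sqrt z UpperHalfPlane.I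
  rw [UpperHalfPlane.I_im, mul_one] at h1
  have h2 : dist (z : ℂ) (UpperHalfPlane.I : UpperHalfPlane) ≤ 2 * |R| + 1 := by
    rw [Complex.dist_eq, UpperHalfPlane.coe_I]
    calc ‖(z : ℂ) - Complex.I‖ ≤ |((z : ℂ) - Complex.I).re| + |((z : ℂ) - Complex.I).im| :=
          Complex.norm_le_abs_re_add_abs_im _
      _ = |z.re| + |z.im - 1| := by simp
      _ ≤ |R| + (|R| + 1) := by
          refine add_le_add (hre.trans (le_abs_self R)) ?_
          calc |z.im - 1| ≤ |z.im| + |(1:ℝ)| := abs_sub _ _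
            _ ≤ |R| + 1 := by
                rw [abs_one, abs_of_pos z.im_pos]
                linarith [him'.trans (le_abs_self R)]
      _ = 2 * |R| + 1 := by ring
  have h3 : Real.sqrt δ ≤ Real.sqrt z.im := Real.sqrt_le_sqrt him
  have hδs : 0 < Real.sqrt δ := Real.sqrt_pos.mpr hδ
  calc dist z UpperHalfPlane.I ≤ dist (z : ℂ) (UpperHalfPlane.I : UpperHalfPlane) / Real.sqrt z.im := h1
    _ ≤ (2 * |R| + 1) / Real.sqrt δ := by
        apply div_le_div₀ (by positivity) h2 hδs h3

/-- A subset of `ℍ` in a box away from the real axis, and its closure, have finite hyperbolic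
area. [folklore] -/
theorem volume_closure_lt_top_of_bounds {S : Set UpperHalfPlane} {R δ : ℝ} (hδ : 0 < δ)
    (hbd : ∀ z ∈ S, |z.re| ≤ R ∧ δ ≤ z.im ∧ z.im ≤ R) : volume (closure S) < ⊤ := by
  have hsub : closure S ⊆ Metric.closedBall UpperHalfPlane.I ((2 * |R| + 1) / Real.sqrt δ) :=
    closure_minimal (subset_closedBall_I_of_bounds hδ hbd) Metric.isClosed_closedBall
  exact lt_of_le_of_lt (measure_mono hsub) (isCompact_closedBall _ _).measure_lt_top

/-- The closure of a set in a box stays in the box. [folklore] -/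
theorem bounds_closure {S : Set UpperHalfPlane} {R δ : ℝ}
    (hbd : ∀ z ∈ S, |z.re| ≤ R ∧ δ ≤ z.im ∧ z.im ≤ R) :
    ∀ z ∈ closure S, |z.re| ≤ R ∧ δ ≤ z.im ∧ z.im ≤ R := by
  have hclosed : IsClosed {z : UpperHalfPlane | |z.re| ≤ R ∧ δ ≤ z.im ∧ z.im ≤ R} := by
    exact (isClosed_le (continuous_abs.comp UpperHalfPlane.continuous_re) continuous_const).inter
      ((isClosed_le continuous_const UpperHalfPlane.continuous_im).inter
        (isClosed_le UpperHalfPlane.continuous_im continuous_const))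
  exact fun z hz => (closure_minimal (fun z hz => hbd z hz) hclosed) hz

/-! ### 4. The section `{0 < det ≤ 1, x • i ∈ S}` of the cone: bounded, with null boundary -/

section Frontier

variable {S : Set UpperHalfPlane} {R δ : ℝ}

/-- The rows of `x` as complex numbers depend continuously on `x`. [folklore] -/
theorem continuous_row (i : Fin 2) :
    Continuous fun x : Fin 2 × Fin 2 → ℝ => (⟨x (i, 0), x (i, 1)⟩ : ℂ) := by
  have h : (fun x : Fin 2 × Fin 2 → ℝ => (⟨x (i, 0), x (i, 1)⟩ : ℂ)) =
      fun x => (x (i, 0) : ℂ) + (x (i, 1) : ℂ) * Complex.I := by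
    funext x; exact Complex.mk_eq_add_mul_I _ _
  rw [h]
  exact ((Complex.continuous_ofReal.comp (continuous_apply _)).add
    ((Complex.continuous_ofReal.comp (continuous_apply _)).mul continuous_const))

/-- **The cone section is bounded**: on `{0 < det x ≤ 1, x • i ∈ S}` every entry is at most
`√((2R² + 1)/δ)` in absolute value. [folklore] -/
theorem isBounded_cone_one (hδ : 0 < δ) (hbd : ∀ z ∈ S, |z.re| ≤ R ∧ δ ≤ z.im ∧ z.im ≤ R) :
    IsBounded {x : Fin 2 × Fin 2 → ℝ | ∃ g : GL (Fin 2) ℝ, (∀ i j, g i j = x (i, j)) ∧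
      0 < g.det.val ∧ g.det.val ≤ 1 ∧ g • UpperHalfPlane.I ∈ S} := by
  rw [isBounded_iff_forall_norm_le]
  refine ⟨Real.sqrt ((2 * R ^ 2 + 1) / δ), fun x hx => ?_⟩
  obtain ⟨hpos, hle, hmem⟩ := (exists_gl_entries_iff' x (fun t => t ≤ 1) S).mp hx
  obtain ⟨him0, hτ⟩ := mem_image_coe_iff.mp hmem
  obtain ⟨hre, him, him'⟩ := hbd _ hτ
  have hsum := normSq_add_normSq_le hδ hpos hre him him'
  have hK : Complex.normSq (⟨x (0, 0), x (0, 1)⟩ : ℂ) + Complex.normSq (⟨x (1, 0), x (1, 1)⟩ : ℂ) ≤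
      (2 * R ^ 2 + 1) / δ := by
    refine hsum.trans ?_
    have hKpos : 0 ≤ (2 * R ^ 2 + 1) / δ := by positivity
    nlinarith
  refine (pi_norm_le_iff_of_nonneg (Real.sqrt_nonneg _)).mpr fun k => ?_
  rw [Real.norm_eq_abs]
  exact Real.abs_le_sqrt ((sq_entry_le_normSq_add_normSq x k).trans hK)

/-- **The boundary of the cone section is null.** For `S` measurable with `μ(∂S) = 0`, in a box
away from the real axis, the topological boundary of `{x : 0 < det x ≤ 1, x • i ∈ S}` in
`ℝ^{Fin 2 × Fin 2}` is Lebesgue-null: it lies in `{0} ∪ {det = 1, x • i ∈ S̄} ∪ {x • i ∈ ∂S}`. [folklore] -/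
theorem volume_frontier_cone_one (hfr : volume (frontier S) = 0)
    (hδ : 0 < δ) (hbd : ∀ z ∈ S, |z.re| ≤ R ∧ δ ≤ z.im ∧ z.im ≤ R) :
    volume (frontier {x : Fin 2 × Fin 2 → ℝ | ∃ g : GL (Fin 2) ℝ, (∀ i j, g i j = x (i, j)) ∧
      0 < g.det.val ∧ g.det.val ≤ 1 ∧ g • UpperHalfPlane.I ∈ S}) = 0 := by
  -- notation
  set C₁ : Set (Fin 2 × Fin 2 → ℝ) := {x | ∃ g : GL (Fin 2) ℝ, (∀ i j, g i j = x (i, j)) ∧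
    0 < g.det.val ∧ g.det.val ≤ 1 ∧ g • UpperHalfPlane.I ∈ S} with hC₁
  set rr : (Fin 2 × Fin 2 → ℝ) → ℂ := fun x => ⟨x (0, 0), x (0, 1)⟩ with hrr
  set ww : (Fin 2 × Fin 2 → ℝ) → ℂ := fun x => ⟨x (1, 0), x (1, 1)⟩ with hww
  set d : (Fin 2 × Fin 2 → ℝ) → ℝ := fun x => (conj (rr x) * ww x).im with hd
  set ψ : (Fin 2 × Fin 2 → ℝ) → ℂ := fun x => conj (rr x / ww x) with hψ
  have hrc : Continuous rr := continuous_row 0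
  have hwc : Continuous ww := continuous_row 1
  have hdc : Continuous d := Complex.continuous_im.comp ((Complex.continuous_conj.comp hrc).mul hwc)
  have hψc : ContinuousOn ψ {x | ww x ≠ 0} := fun x hx =>
    (Complex.continuous_conj.continuousAt.comp (hrc.continuousAt.div hwc.continuousAt hx)).continuousWithinAt
  have hwne : ∀ x, 0 < d x → ww x ≠ 0 := by
    intro x hx h0
    simp only [hd, h0, mul_zero, Complex.zero_im] at hx
    exact lt_irrefl _ hx
  -- membership in the cone sections
  have hmemC₁ : ∀ x, x ∈ C₁ ↔ 0 < d x ∧ d x ≤ 1 ∧ ψ x ∈ UpperHalfPlane.coe '' S := fun x =>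
    exists_gl_entries_iff' x (fun t => t ≤ 1) S
  set K : ℝ := (2 * R ^ 2 + 1) / δ with hK
  -- (F1) the closure lies in the closed set `Q`
  set Q : Set (Fin 2 × Fin 2 → ℝ) := {x | Complex.normSq (rr x) + Complex.normSq (ww x) ≤ K * d x} ∩
    ({x | d x ≤ 1} ∩ {x | 0 ≤ d x}) with hQ
  have hQc : IsClosed Q := by
    refine (isClosed_le ((Complex.continuous_normSq.comp hrc).add (Complex.continuous_normSq.comp hwc))
      (continuous_const.mul hdc)).inter ((isClosed_le hdc continuous_const).inter
      (isClosed_le continuous_const hdc))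
  have hC₁Q : C₁ ⊆ Q := by
    intro x hx
    obtain ⟨hpos, hle, hmem⟩ := (hmemC₁ x).mp hx
    obtain ⟨him0, hτ⟩ := mem_image_coe_iff.mp hmem
    obtain ⟨hre, him, him'⟩ := hbd _ hτ
    exact ⟨normSq_add_normSq_le hδ hpos hre him him', hle, hpos.le⟩
  have hclQ : closure C₁ ⊆ Q := closure_minimal hC₁Q hQc
  -- (F3) over the closure the base point lies in `S̄`
  have hcl_coe : closure S = UpperHalfPlane.coe ⁻¹' closure (UpperHalfPlane.coe '' S) :=
    UpperHalfPlane.isOpenEmbedding_coe.isInducing.closure_eq_preimage_closure_image S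
  have hψcl : ∀ x ∈ closure C₁, 0 < d x → ψ x ∈ closure (UpperHalfPlane.coe '' S) := by
    intro x hx hdx
    have h1 : ψ x ∈ closure (ψ '' C₁) :=
      ((hψc x (hwne x hdx)).mono_of_mem_nhdsWithin ?_).mem_closure_image hx
    · refine closure_mono ?_ h1
      rintro _ ⟨y, hy, rfl⟩
      exact ((hmemC₁ y).mp hy).2.2
    · exact mem_nhdsWithin_of_mem_nhds ((isOpen_ne_fun hwc continuous_const).mem_nhds (hwne x hdx))
  have hψim : ∀ x, 0 < d x → 0 < (ψ x).im := by
    intro x hdx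
    have h := (normSq_mul_im_conj_div (rr x) (ww x) (hwne x hdx)).1
    have hw0 : 0 < Complex.normSq (ww x) := Complex.normSq_pos.mpr (hwne x hdx)
    have : 0 < Complex.normSq (ww x) * (ψ x).im := by rw [hψ]; rw [h]; exact hdx
    exact pos_of_mul_pos_right this hw0.le
  -- (F4) interior points: `0 < det < 1` and base point in the interior of `S`
  have hint : ∀ x, 0 < d x → d x < 1 → ψ x ∈ UpperHalfPlane.coe '' interior S → x ∈ interior C₁ := by
    intro x hdx hd1 hmem
    set V : Set (Fin 2 × Fin 2 → ℝ) := ({y | ww y ≠ 0} ∩ ψ ⁻¹' (UpperHalfPlane.coe '' interior S)) ∩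
      d ⁻¹' Set.Ioo 0 1 with hV
    have hVo : IsOpen V := by
      refine (hψc.isOpen_inter_preimage (isOpen_ne_fun hwc continuous_const) ?_).inter
        (hdc.isOpen_preimage _ isOpen_Ioo)
      exact UpperHalfPlane.isOpenEmbedding_coe.isOpenMap _ isOpen_interior
    have hVC : V ⊆ C₁ := by
      rintro y ⟨⟨-, hyψ⟩, hy0, hy1⟩
      refine (hmemC₁ y).mpr ⟨hy0, hy1.le, ?_⟩
      obtain ⟨τ, hτ, hτy⟩ := hyψ
      exact ⟨τ, interior_subset hτ, hτy⟩
    exact interior_maximal hVC hVo ⟨⟨hwne x hdx, hmem⟩, hdx, hd1⟩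
  -- (F5) the boundary lies in three null pieces
  set Z₁ : Set (Fin 2 × Fin 2 → ℝ) := {x | ∃ g : GL (Fin 2) ℝ, (∀ i j, g i j = x (i, j)) ∧
    0 < g.det.val ∧ g.det.val = 1 ∧ g • UpperHalfPlane.I ∈ closure S} with hZ₁
  set N : Set (Fin 2 × Fin 2 → ℝ) := {x | ∃ g : GL (Fin 2) ℝ, (∀ i j, g i j = x (i, j)) ∧
    0 < g.det.val ∧ g • UpperHalfPlane.I ∈ frontier S} with hN
  have hsub : frontier C₁ ⊆ {0} ∪ Z₁ ∪ N := by
    intro x hx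
    have hxcl : x ∈ closure C₁ := frontier_subset_closure hx
    have hxint : x ∉ interior C₁ := fun h => hx.2 h
    obtain ⟨hQ1, hQ2, hQ3⟩ := hclQ hxcl
    have hQ1' : Complex.normSq (rr x) + Complex.normSq (ww x) ≤ K * d x := hQ1
    have hQ2' : d x ≤ 1 := hQ2
    have hQ3' : 0 ≤ d x := hQ3
    rcases hQ3'.lt_or_eq with hdx | hdx
    · -- `0 < det`
      have hzcl : (⟨ψ x, hψim x hdx⟩ : UpperHalfPlane) ∈ closure S := by
        rw [hcl_coe]; exact hψcl x hxcl hdx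
      rcases hQ2'.lt_or_eq with hd1 | hd1
      · -- `det < 1`: the base point is on `∂S`
        refine Or.inr ?_
        rw [hN, Set.mem_setOf_eq]
        have h' := (exists_gl_entries_iff' x (fun _ => True) (frontier S))
        simp only [true_and] at h'
        refine h'.mpr ⟨hdx, ⟨⟨ψ x, hψim x hdx⟩, ⟨hzcl, fun hint' => hxint ?_⟩, rfl⟩⟩
        exact hint x hdx hd1 ⟨_, hint', rfl⟩
      · -- `det = 1`
        refine Or.inl (Or.inr ?_)
        rw [hZ₁, Set.mem_setOf_eq, exists_gl_entries_iff' x (fun t => t = 1) (closure S)]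
        exact ⟨hdx, hd1, ⟨⟨ψ x, hψim x hdx⟩, hzcl, rfl⟩⟩
    · -- `det = 0`: then `x = 0`
      refine Or.inl (Or.inl ?_)
      rw [Set.mem_singleton_iff]
      have h0 : Complex.normSq (rr x) + Complex.normSq (ww x) ≤ 0 := by
        rw [← hdx, mul_zero] at hQ1'; exact hQ1'
      funext k
      have hk := sq_entry_le_normSq_add_normSq x k
      have : x k ^ 2 ≤ 0 := hk.trans h0
      simpa using pow_eq_zero_iff (n := 2) two_ne_zero |>.mp (le_antisymm this (sq_nonneg _))
  -- (F6) nullity of the pieces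
  have hN0 : volume N = 0 := volume_cone_eq_zero_of_null' measurableSet_frontier hfr
  have hZ0 : volume Z₁ = 0 := by
    -- squeeze between the cones `det ≤ 1` and `det ≤ 1 - ε` over `S̄`
    have hSc : MeasurableSet (closure S) := isClosed_closure.measurableSet
    have hv : volume (closure S) ≠ ⊤ := (volume_closure_lt_top_of_bounds hδ hbd).ne
    set A : ℝ → Set (Fin 2 × Fin 2 → ℝ) := fun t => {x | ∃ g : GL (Fin 2) ℝ, (∀ i j, g i j = x (i, j)) ∧
      0 < g.det.val ∧ g.det.val ≤ t ∧ g • UpperHalfPlane.I ∈ closure S} with hA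
    have hAvol : ∀ t, 0 ≤ t → volume (A t) = ENNReal.ofReal (π * t ^ 2 / 2) * volume (closure S) :=
      fun t ht => volume_cone_eq' hSc ht
    have hAm : ∀ t, MeasurableSet (A t) := fun t => measurableSet_cone' hSc (p := fun s => s ≤ t) measurableSet_Iic
    have hmemA : ∀ t x, x ∈ A t ↔ 0 < d x ∧ d x ≤ t ∧ ψ x ∈ UpperHalfPlane.coe '' closure S :=
      fun t x => exists_gl_entries_iff' x (fun s => s ≤ t) (closure S)
    have hmemZ : ∀ x, x ∈ Z₁ ↔ 0 < d x ∧ d x = 1 ∧ ψ x ∈ UpperHalfPlane.coe '' closure S :=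
      fun x => exists_gl_entries_iff' x (fun s => s = 1) (closure S)
    have hbound : ∀ ε : ℝ, 0 < ε → ε < 1 →
        volume Z₁ ≤ ENNReal.ofReal (π * ε) * volume (closure S) := by
      intro ε hε hε1
      have hZA : Z₁ ⊆ A 1 \ A (1 - ε) := by
        intro x hx
        obtain ⟨hdx, hd1, hmem⟩ := (hmemZ x).mp hx
        refine ⟨(hmemA 1 x).mpr ⟨hdx, hd1.le, hmem⟩, fun h => ?_⟩
        obtain ⟨-, hle, -⟩ := (hmemA (1 - ε) x).mp h
        linarith
      have hAA : A (1 - ε) ⊆ A 1 := by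
        intro x hx
        obtain ⟨hdx, hle, hmem⟩ := (hmemA (1 - ε) x).mp hx
        exact (hmemA 1 x).mpr ⟨hdx, by linarith, hmem⟩
      have hfin : volume (A (1 - ε)) ≠ ⊤ := by
        rw [hAvol (1 - ε) (by linarith)]
        exact ENNReal.mul_ne_top ENNReal.ofReal_ne_top hv
      have hZm : MeasurableSet Z₁ := measurableSet_cone' hSc (p := fun s => s = 1) (measurableSet_singleton 1)
      have hdisj : Disjoint Z₁ (A (1 - ε)) := by
        rw [Set.disjoint_left]
        intro x hx h
        exact (hZA hx).2 h
      have hadd : volume Z₁ + volume (A (1 - ε)) ≤ volume (A 1) := by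
        rw [← measure_union hdisj (hAm _)]
        exact measure_mono (Set.union_subset (fun x hx => (hZA hx).1) hAA)
      calc volume Z₁ ≤ volume (A 1) - volume (A (1 - ε)) := ENNReal.le_sub_of_add_le_right hfin hadd
        _ = (ENNReal.ofReal (π * 1 ^ 2 / 2) - ENNReal.ofReal (π * (1 - ε) ^ 2 / 2)) *
              volume (closure S) := by
            rw [hAvol 1 zero_le_one, hAvol (1 - ε) (by linarith), ENNReal.sub_mul (fun _ _ => hv)]
        _ ≤ ENNReal.ofReal (π * ε) * volume (closure S) := by
            gcongr
            rw [← ENNReal.ofReal_sub _ (by positivity)]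
            apply ENNReal.ofReal_le_ofReal
            nlinarith [Real.pi_pos, hε, hε1, mul_nonneg Real.pi_pos.le (sq_nonneg ε)]
    -- let `ε → 0`
    have hlim : Tendsto (fun n : ℕ => ENNReal.ofReal (π * (1 / ((n : ℝ) + 2))) * volume (closure S))
        atTop (𝓝 (0 * volume (closure S))) := by
      refine ENNReal.Tendsto.mul_const ?_ (Or.inr hv)
      rw [← ENNReal.ofReal_zero]
      refine ENNReal.tendsto_ofReal ?_
      have h : Tendsto (fun n : ℕ => π / ((n : ℝ) + 2)) atTop (𝓝 0) := by
        have := (tendsto_const_div_atTop_nhds_zero_nat π).comp (tendsto_add_atTop_nat 2)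
        refine this.congr' (Eventually.of_forall fun n => ?_)
        simp [Function.comp, Nat.cast_add]
      simpa only [mul_one_div] using h
    rw [zero_mul] at hlim
    refine nonpos_iff_eq_zero.mp (ge_of_tendsto' hlim fun n => ?_)
    have hn : (0 : ℝ) < 1 / ((n : ℝ) + 2) := by positivity
    have hn1 : 1 / ((n : ℝ) + 2) < 1 := by
      rw [div_lt_one (by positivity)]; linarith [n.cast_nonneg (α := ℝ)]
    exact hbound _ hn hn1
  refine measure_mono_null hsub (measure_union_null (measure_union_null ?_ hZ0) hN0)
  exact measure_singleton 0

end Frontier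


/-! ### 5. The count -/

/-- Rows of a scalar multiple. [folklore] -/
theorem rows_smul (t : ℝ) (x : Fin 2 × Fin 2 → ℝ) :
    ((⟨(t • x) (0, 0), (t • x) (0, 1)⟩ : ℂ) = (t : ℂ) * ⟨x (0, 0), x (0, 1)⟩) ∧
      ((⟨(t • x) (1, 0), (t • x) (1, 1)⟩ : ℂ) = (t : ℂ) * ⟨x (1, 0), x (1, 1)⟩) := by
  constructor <;> apply Complex.ext <;> simp

/-- **Lattice points in the cone** (Eichler's count, analytic half): for a full lattice
`Λ = ℤ v ⊆ ℝ^{Fin 2 × Fin 2}` (matrices through their entries) and a measurable `S ⊆ ℍ` with null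
boundary inside a box `|Re z| ≤ R`, `δ ≤ Im z ≤ R` (`δ > 0`),
`#{x ∈ Λ : 0 < det x ≤ T, x • i ∈ S} / T² → (π/2) μ(S) / |det v|` as `T → ∞`, where `|det v|`, the
determinant of the entry matrix of `v`, is the covolume of `Λ`. (Mathlib
`ZLattice.covolume.tendsto_card_le_div` with the gauge `det²`, the cone volume `volume_cone_eq`,
boundedness and null boundary of the cone section.) [cite: VignerasLNM800, Ch. IV §1] -/
theorem tendsto_card_cone_div_sq (v : Module.Basis (Fin 2 × Fin 2) ℝ (Fin 2 × Fin 2 → ℝ))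
    {S : Set UpperHalfPlane} (hS : MeasurableSet S) (hfr : volume (frontier S) = 0)
    {R δ : ℝ} (hδ : 0 < δ) (hbd : ∀ z ∈ S, |z.re| ≤ R ∧ δ ≤ z.im ∧ z.im ≤ R) :
    Tendsto (fun T : ℝ => (Nat.card ↥({x : Fin 2 × Fin 2 → ℝ | ∃ g : GL (Fin 2) ℝ,
        (∀ i j, g i j = x (i, j)) ∧ 0 < g.det.val ∧ g.det.val ≤ T ∧ g • UpperHalfPlane.I ∈ S} ∩
        (Submodule.span ℤ (Set.range v) : Set (Fin 2 × Fin 2 → ℝ))) : ℝ) / T ^ 2)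
      atTop (𝓝 (π / 2 * (volume S).toReal / |(Matrix.of fun i k => v i k).det|)) := by
  classical
  set Xc : Set (Fin 2 × Fin 2 → ℝ) := {x | ∃ g : GL (Fin 2) ℝ, (∀ i j, g i j = x (i, j)) ∧
    0 < g.det.val ∧ g • UpperHalfPlane.I ∈ S} with hXc
  set F : (Fin 2 × Fin 2 → ℝ) → ℝ := fun x => (x (0, 0) * x (1, 1) - x (0, 1) * x (1, 0)) ^ 2 with hF
  set C : ℝ → Set (Fin 2 × Fin 2 → ℝ) := fun T => {x | ∃ g : GL (Fin 2) ℝ, (∀ i j, g i j = x (i, j)) ∧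
    0 < g.det.val ∧ g.det.val ≤ T ∧ g • UpperHalfPlane.I ∈ S} with hC
  -- memberships through the rows
  have hmemX : ∀ x, x ∈ Xc ↔ 0 < (conj (⟨x (0, 0), x (0, 1)⟩ : ℂ) * ⟨x (1, 0), x (1, 1)⟩).im ∧
      conj ((⟨x (0, 0), x (0, 1)⟩ : ℂ) / ⟨x (1, 0), x (1, 1)⟩) ∈ UpperHalfPlane.coe '' S := by
    intro x
    have h := exists_gl_entries_iff' x (fun _ => True) S
    simp only [true_and] at h
    exact h
  have hmemC : ∀ T x, x ∈ C T ↔ 0 < (conj (⟨x (0, 0), x (0, 1)⟩ : ℂ) * ⟨x (1, 0), x (1, 1)⟩).im ∧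
      (conj (⟨x (0, 0), x (0, 1)⟩ : ℂ) * ⟨x (1, 0), x (1, 1)⟩).im ≤ T ∧
      conj ((⟨x (0, 0), x (0, 1)⟩ : ℂ) / ⟨x (1, 0), x (1, 1)⟩) ∈ UpperHalfPlane.coe '' S :=
    fun T x => exists_gl_entries_iff' x (fun t => t ≤ T) S
  have hFd : ∀ x, F x = (conj (⟨x (0, 0), x (0, 1)⟩ : ℂ) * ⟨x (1, 0), x (1, 1)⟩).im ^ 2 := by
    intro x; rw [im_conj_mul_eq_det]
  -- `{F ≤ c²}` on the cone is the section `det ≤ c`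
  have hXF : ∀ c : ℝ, 0 < c → {x ∈ Xc | F x ≤ c ^ 2} = C c := by
    intro c hc
    ext x
    rw [Set.mem_setOf_eq, hmemX, hmemC, hFd]
    constructor
    · rintro ⟨⟨hpos, hmem⟩, hle⟩
      exact ⟨hpos, (pow_le_pow_iff_left₀ hpos.le hc.le two_ne_zero).mp hle, hmem⟩
    · rintro ⟨hpos, hle, hmem⟩
      exact ⟨⟨hpos, hmem⟩, (pow_le_pow_iff_left₀ hpos.le hc.le two_ne_zero).mpr hle⟩
  have hXF1 : {x ∈ Xc | F x ≤ 1} = C 1 := by rw [← hXF 1 one_pos, one_pow]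
  -- hypotheses of Mathlib's count
  have hX : ∀ ⦃x⦄ ⦃r : ℝ⦄, x ∈ Xc → 0 < r → r • x ∈ Xc := by
    intro x r hx hr
    rw [hmemX] at hx ⊢
    obtain ⟨h1, h2⟩ := rows_smul r x
    rw [h1, h2, map_mul, Complex.conj_ofReal, mul_mul_mul_comm, ← Complex.ofReal_mul,
      Complex.im_ofReal_mul, mul_div_mul_left _ _ (Complex.ofReal_ne_zero.mpr hr.ne')]
    exact ⟨mul_pos (mul_pos hr hr) hx.1, hx.2⟩
  have h1 : ∀ x ⦃r : ℝ⦄, 0 ≤ r → F (r • x) = r ^ Fintype.card (Fin 2 × Fin 2) * F x := by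
    intro x r _
    simp only [hF, Pi.smul_apply, smul_eq_mul, Fintype.card_prod, Fintype.card_fin]
    ring
  have h2 : IsBounded {x ∈ Xc | F x ≤ 1} := by rw [hXF1]; exact isBounded_cone_one hδ hbd
  have h3 : MeasurableSet {x ∈ Xc | F x ≤ 1} := by
    rw [hXF1]; exact measurableSet_cone' hS (p := fun t => t ≤ 1) measurableSet_Iic
  have h4 : volume (frontier {x | x ∈ Xc ∧ F x ≤ 1}) = 0 := by
    have : {x | x ∈ Xc ∧ F x ≤ 1} = C 1 := hXF1
    rw [this]
    exact volume_frontier_cone_one hfr hδ hbd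
  have hmain := ZLattice.covolume.tendsto_card_le_div (Submodule.span ℤ (Set.range v)) hX h1 h2 h3 h4
  -- the value of the limit
  have hvol : volume.real {x ∈ Xc | F x ≤ 1} = π / 2 * (volume S).toReal := by
    rw [measureReal_def, hXF1, show C 1 = {x | ∃ g : GL (Fin 2) ℝ, (∀ i j, g i j = x (i, j)) ∧
      0 < g.det.val ∧ g.det.val ≤ 1 ∧ g • UpperHalfPlane.I ∈ S} from rfl, volume_cone_eq' hS zero_le_one,
      ENNReal.toReal_mul, ENNReal.toReal_ofReal (by positivity)]
    ring
  have hcov : ZLattice.covolume (Submodule.span ℤ (Set.range v)) = |(Matrix.of fun i k => v i k).det| := by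
    rw [ZLattice.covolume_eq_det (Submodule.span ℤ (Set.range v)) (v.restrictScalars ℤ)]
    congr 2
    ext i k
    simp [Module.Basis.restrictScalars_apply]
  rw [hvol, hcov] at hmain
  -- substitute `c = T²`
  refine ((hmain.comp (tendsto_pow_atTop two_ne_zero)).congr' ?_)
  filter_upwards [eventually_gt_atTop 0] with T hT
  simp only [Function.comp_apply]
  rw [hXF T hT]

end Literature.NumberTheory.Automorphic

end
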